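import Summits.ABC.ABC.Theorems.IsogenyGlueCongruenceEllipticGluingPrimeBoundStubCMTorsionCoreOfAux2
import Summits.ABC.ABC.Theorems.IsogenyGlueCongruenceEllipticGluingPrimeBoundStubCMIsotypicCoreOfAux1
import HarnessLib

/-!
# CM torsion core, helpers 3/8: the CM character is FACT 2’s character; the module in matrices

Helper file (3/8) for stub `stub_CMTorsionCoreOf` ((K†), the CM torsion core) of line
`Sketch` (isotypic–Minkowski reduction) of crux U
`Summit.ABC.ABC.Theses.IsogenyGlueCongruence.EllipticGluingPrimeBound` (stmt-ABC-13919); the stub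
itself is proved in `…EllipticGluingPrimeBoundStubCMTorsionCoreOf`.

* `units_eq_of_nonscalar` (registered sub-goal) — on the FACT-2 plane at `ℓ > 25`, a non-scalar
  endomorphism `ψ` which is semi-equivariant for a character `ε` has `ε = χ` (the Cartan clause
  produces a non-scalar element of `ker χ ∩ ker ε` acting inside `𝔽_ℓ[φ]`, via the binomial
  identity `CMIsotypicCore.C_add_X_pow_twelve` of the line and the counting step of helpers 2/8);
* `CMTorsion.matrices_of_module` — the FACT-2 plane and an equivariant injective `j : V → V^r`,
  written in `2 × 2` matrices over `𝔽_ℓ` in a basis of `V`.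

Everything is proved; no `def`, no named fact. Deliberately NOT here: the eigen-computation over
`𝔽̄_ℓ` (helpers 4/8) and the count (helpers 5/8).
-/

noncomputable section

-- `Summit.<Summit>.<Problem>` is the mandated summit-side namespace (CONVENTIONS §2); for the
-- single-conjunct summit `ABC` the two coincide, so the duplicate `ABC.ABC` is deliberate.
set_option linter.dupNamespace false

namespace Summit.ABC.ABC.Theorems.IsotypicMinkowski

open scoped AddSubgroup Matrix

open Literature.AlgebraicGeometry.Motives

/-! ## The CM character is FACT 2’s character (registered sub-goal of the stub) -/


/-- **The CM character is FACT 2's character.** On the FACT-2 plane `V` at a prime `ℓ > 25`, an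
additive endomorphism `ψ` of `V` which is `ε`-semi-equivariant (`ψ(σv) = ε(σ) σ ψ(v)`) for some
character `ε` and not a scalar has `ε = χ`: an element `τ ∈ ker χ` acting as `(a + √D)^{12}` with
`P(a) Q(a) ≠ 0` (counting) has `τ² ∈ ker χ ∩ ker ε` acting as the non-scalar `α + β φ`,
`β = 2 P(a) Q(a)`, so `ψ` lies in the commutant `𝔽_ℓ[φ]`; then `ker χ ⊆ ker ε` (else `2ψ = 0`) and
`ker ε ⊆ ker χ` (else `ψ` commutes with an element anti-commuting with `φ`, forcing `ψ ∈ 𝔽_ℓ`).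
[folklore] -/
theorem units_eq_of_nonscalar {Γ V : Type} [Group Γ] [AddCommGroup V]
    [DistribMulAction Γ V] {ℓ : ℕ} [Fact ℓ.Prime] [Module (ZMod ℓ) V]
    (h25 : 25 < ℓ) (hcard : Nat.card V = ℓ ^ 2)
    (φ : AddMonoid.End V) (D : ℤ) (χ : Γ →* ℤˣ)
    (hφφ : ∀ v, φ (φ v) = D • v) (hD : ¬ (ℓ : ℤ) ∣ D) (hns : ∀ c : ℤ, ∃ v, φ v ≠ c • v)
    (hχ : ∃ σ, χ σ ≠ 1)
    (hsemi : ∀ (σ : Γ) (v : V), φ (σ • v) = ((χ σ : ℤˣ) : ℤ) • σ • φ v)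
    (hbig : ∀ a b : ℤ, ¬ (ℓ : ℤ) ∣ a ^ 2 - D * b ^ 2 → ∃ σ : Γ, χ σ = 1 ∧ ∀ v : V,
      σ • v = (((a : AddMonoid.End V) + (b : AddMonoid.End V) * φ) ^ 12) v)
    (ψ : AddMonoid.End V) (ε : Γ →* ℤˣ)
    (hψ : ∀ (σ : Γ) (v : V), ψ (σ • v) = ((ε σ : ℤˣ) : ℤ) • σ • ψ v)
    (hψns : ∀ c : ℤ, ∃ v, ψ v ≠ c • v) : ∀ σ, ε σ = χ σ := by
  classical
  have hprime : ℓ.Prime := Fact.out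
  haveI : Finite V := Nat.finite_of_card_ne_zero (by rw [hcard]; exact pow_ne_zero _ hprime.ne_zero)
  haveI : Nontrivial V := by
    rw [← Finite.one_lt_card_iff_nontrivial, hcard]
    exact Nat.one_lt_pow two_ne_zero hprime.one_lt
  haveI : Module.Finite (ZMod ℓ) V := Module.Finite.of_finite
  have hrank : Module.finrank (ZMod ℓ) V = 2 := by
    have h := Module.natCard_eq_pow_finrank (K := ZMod ℓ) (V := V)
    rw [hcard, Nat.card_zmod] at h
    exact (Nat.pow_right_injective hprime.two_le h).symm
  have hmul : ∀ (f g : AddMonoid.End V) (v : V), (f * g) v = f (g v) := fun _ _ _ ↦ rfl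
  have hadd : ∀ (f g : AddMonoid.End V) (v : V), (f + g) v = f v + g v := fun _ _ _ ↦ rfl
  have hσz : ∀ (σ : Γ) (n : ℤ) (v : V), σ • (n • v) = n • σ • v :=
    fun σ n v ↦ map_zsmul (DistribSMul.toAddMonoidHom V σ) n v
  have hσq : ∀ (σ : Γ) (c : ZMod ℓ) (v : V), σ • (c • v) = c • σ • v :=
    fun σ c v ↦ ZMod.map_smul (DistribSMul.toAddMonoidHom V σ) c v
  have h2 : (2 : ZMod ℓ) ≠ 0 := by
    intro h
    have h' : ((2 : ℕ) : ZMod ℓ) = 0 := by exact_mod_cast h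
    rw [ZMod.natCast_eq_zero_iff] at h'
    have := Nat.le_of_dvd two_pos h'
    omega
  -- linear versions
  let φL : Module.End (ZMod ℓ) V := (φ : V →+ V).toZModLinearMap ℓ
  let ψL : Module.End (ZMod ℓ) V := (ψ : V →+ V).toZModLinearMap ℓ
  have hφL : ∀ v, φL v = φ v := fun _ ↦ rfl
  have hψL : ∀ v, ψL v = ψ v := fun _ ↦ rfl
  have hDmod : ((D : ℤ) : ZMod ℓ) ≠ 0 := fun h ↦ hD ((ZMod.intCast_zmod_eq_zero_iff_dvd D ℓ).1 h)
  have hφinj : ∀ v : V, φ v = 0 → v = 0 := fun v hv ↦ by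
    have h1 : D • v = 0 := by rw [← hφφ, hv, map_zero]
    have h3 : ((D : ℤ) : ZMod ℓ) • v = 0 := by rwa [Int.cast_smul_eq_zsmul]
    exact (smul_eq_zero.1 h3).resolve_left hDmod
  -- a scalar endomorphism contradicts non-scalarity
  have hscalar : ∀ (f : AddMonoid.End V) (c : ZMod ℓ), (∀ d : ℤ, ∃ v, f v ≠ d • v) →
      (f : V →+ V).toZModLinearMap ℓ ≠ c • 1 := by
    intro f c hf hc
    obtain ⟨v, hv⟩ := hf (c.val : ℤ)
    apply hv
    have h := congrArg (fun g : Module.End (ZMod ℓ) V ↦ g v) hc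
    simp only [LinearMap.smul_apply, Module.End.one_apply] at h
    change f v = c • v at h
    rw [h]
    conv_rhs => rw [natCast_zsmul, ← Nat.cast_smul_eq_nsmul (ZMod ℓ), ZMod.natCast_zmod_val]
  have hns' : ¬ ∃ c : ZMod ℓ, φL = c • 1 := fun ⟨c, hc⟩ ↦ hscalar φ c hns hc
  -- `σ₀` with `χ σ₀ = -1`: `φ` anti-commutes with `σ₀`
  obtain ⟨σ₀, hσ₀⟩ := hχ
  have hχ₀ : ((χ σ₀ : ℤˣ) : ℤ) = -1 := by
    rw [(Int.units_eq_one_or (χ σ₀)).resolve_left hσ₀]; rfl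
  -- `τ ∈ ker χ` acting as `(a + √D)^{12} = P(a) + Q(a) √D` with `ℓ ∤ P(a) Q(a)`
  obtain ⟨x, hx1, hx2, hx3⟩ := CMTorsion.exists_sq_ne_and_eval_ne_zero₂ h25 ((D : ℤ) : ZMod ℓ)
  set a : ℤ := ((x.val : ℕ) : ℤ) with ha_def
  have ha : ((a : ℤ) : ZMod ℓ) = x := by rw [ha_def, Int.cast_natCast, ZMod.natCast_zmod_val]
  set Qa : ℤ := 12 * a ^ 11 + 220 * a ^ 9 * D + 792 * a ^ 7 * D ^ 2 + 792 * a ^ 5 * D ^ 3 +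
    220 * a ^ 3 * D ^ 4 + 12 * a * D ^ 5 with hQa_def
  set Pa : ℤ := a ^ 12 + 66 * a ^ 10 * D + 495 * a ^ 8 * D ^ 2 + 924 * a ^ 6 * D ^ 3 +
    495 * a ^ 4 * D ^ 4 + 66 * a ^ 2 * D ^ 5 + D ^ 6 with hPa_def
  have haunit : ¬ (ℓ : ℤ) ∣ a ^ 2 - D * 1 ^ 2 := fun h ↦ by
    apply hx1
    have h' := (ZMod.intCast_zmod_eq_zero_iff_dvd _ ℓ).2 h
    push_cast [ha] at h'
    linear_combination h'
  have hQmod : ((Qa : ℤ) : ZMod ℓ) ≠ 0 := fun h ↦ by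
    apply hx2
    rw [hQa_def] at h
    push_cast [ha] at h
    linear_combination h
  have hPmod : ((Pa : ℤ) : ZMod ℓ) ≠ 0 := fun h ↦ by
    apply hx3
    rw [hPa_def] at h
    push_cast [ha] at h
    linear_combination h
  obtain ⟨τ, hτ1, hτ⟩ := hbig a 1 haunit
  have hφ2 : φ ^ 2 = (D : AddMonoid.End V) := by
    refine DFunLike.ext _ _ fun v ↦ ?_
    rw [sq, hmul, hφφ, AddMonoid.End.intCast_apply]
  have hT : ((a : AddMonoid.End V) + φ) ^ 12 = (Pa : AddMonoid.End V) + φ * (Qa : AddMonoid.End V)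
      := by
    have h := congrArg (Polynomial.aeval (R := ℤ) φ) (CMIsotypicCore.C_add_X_pow_twelve a)
    simp only [map_pow, map_add, map_mul, Polynomial.aeval_C, Polynomial.aeval_X,
      algebraMap_int_eq, Int.coe_castRingHom, map_ofNat] at h
    rw [hφ2] at h
    rw [h, hPa_def, hQa_def]
    congr 1
    · push_cast; rfl
    · congr 1; push_cast; rfl
  have hτ' : ∀ v : V, τ • v = Pa • v + φ (Qa • v) := fun v ↦ by
    rw [hτ v, Int.cast_one, one_mul, hT, hadd, hmul, AddMonoid.End.intCast_apply,
        AddMonoid.End.intCast_apply]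
  -- `w = τ²` acts as `α + β φ` with `β = 2 P(a) Q(a) ≠ 0`
  set α : ZMod ℓ := ((Pa : ℤ) : ZMod ℓ) ^ 2 + ((Qa : ℤ) : ZMod ℓ) ^ 2 * ((D : ℤ) : ZMod ℓ) with hα
  set β : ZMod ℓ := 2 * ((Pa : ℤ) : ZMod ℓ) * ((Qa : ℤ) : ZMod ℓ) with hβ
  have hβ0 : β ≠ 0 := mul_ne_zero (mul_ne_zero h2 hPmod) hQmod
  let wL : Module.End (ZMod ℓ) V := (DistribSMul.toAddMonoidHom V (τ * τ)).toZModLinearMap ℓ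
  have hwL : ∀ v, wL v = (τ * τ) • v := fun _ ↦ rfl
  have hτL : ∀ v : V, τ • v = ((Pa : ℤ) : ZMod ℓ) • v + ((Qa : ℤ) : ZMod ℓ) • φ v := fun v ↦ by
    rw [hτ', ← Int.cast_smul_eq_zsmul (ZMod ℓ) Pa, ← Int.cast_smul_eq_zsmul (ZMod ℓ) Qa,
        ZMod.map_smul]
  have hwαβ : wL = α • 1 + β • φL := by
    refine LinearMap.ext fun v ↦ ?_
    rw [hwL, mul_smul, hτL, hτL, smul_add, map_add, ZMod.map_smul, ZMod.map_smul, hφφ,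
      ← Int.cast_smul_eq_zsmul (ZMod ℓ) D,
      LinearMap.add_apply, LinearMap.smul_apply, LinearMap.smul_apply, Module.End.one_apply, hφL,
          hα, hβ]
    module
  have hwns : ¬ ∃ c : ZMod ℓ, wL = c • 1 := by
    rintro ⟨c, hc⟩
    rw [hwαβ] at hc
    have h1 : (α - c) • (1 : Module.End (ZMod ℓ) V) + β • φL = 0 := by
      rw [sub_smul, ← hc]; abel
    by_cases hαc : α - c = 0
    · rw [hαc, zero_smul, zero_add] at h1
      rcases smul_eq_zero.1 h1 with h | h
      · exact hβ0 h
      · apply hns'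
        exact ⟨0, by rw [h, zero_smul]⟩
    · apply hns'
      refine ⟨-(β⁻¹ * (α - c)), ?_⟩
      have h3 : β • φL = -((α - c) • (1 : Module.End (ZMod ℓ) V)) := eq_neg_of_add_eq_zero_right h1
      calc φL = β⁻¹ • (β • φL) := by rw [smul_smul, inv_mul_cancel₀ hβ0, one_smul]
        _ = -(β⁻¹ * (α - c)) • 1 := by rw [h3, smul_neg, smul_smul, neg_smul]
  -- `ψ` commutes with `w` (`ε(τ²) = 1`), hence `ψ = A + B φ`
  have hψw : ψL * wL = wL * ψL := by
    refine LinearMap.ext fun v ↦ ?_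
    rw [Module.End.mul_apply, Module.End.mul_apply, hwL, hψL, hψL, hwL, hψ, map_mul,
        Int.units_mul_self,
      Units.val_one, one_zsmul]
  obtain ⟨p', q', hpq'⟩ := exists_eq_smul_one_add_smul_of_commute hrank hwns hψw
  set A : ZMod ℓ := p' + q' * α with hA
  set B : ZMod ℓ := q' * β with hB
  have hψAB : ψL = A • 1 + B • φL :=
      by rw [hpq', hwαβ, hA, hB, smul_add, smul_smul, smul_smul]; module
  have hψv : ∀ v, ψ v = A • v + B • φ v := fun v ↦ by
    rw [← hψL, hψAB, LinearMap.add_apply, LinearMap.smul_apply, LinearMap.smul_apply,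
      Module.End.one_apply, hφL]
  -- (1) `χ σ = 1 ⟹ ε σ = 1`
  have h1 : ∀ σ, χ σ = 1 → ε σ = 1 := by
    intro σ hσ
    by_contra hε
    have hε' : ((ε σ : ℤˣ) : ℤ) = -1 := by rw [(Int.units_eq_one_or (ε σ)).resolve_left hε]; rfl
    have hcomm : ∀ v, ψ (σ • v) = σ • ψ v := fun v ↦ by
      rw [hψv, hψv, hsemi, hσ, Units.val_one, one_zsmul, smul_add, hσq, hσq]
    apply hscalar ψ 0 hψns
    rw [zero_smul]
    refine LinearMap.ext fun v ↦ ?_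
    rw [LinearMap.zero_apply, hψL]
    have h4 := hψ σ (σ⁻¹ • v)
    rw [← hcomm, smul_inv_smul, hε', neg_one_zsmul, eq_neg_iff_add_eq_zero, ← two_smul (ZMod
        ℓ)] at h4
    exact (smul_eq_zero.1 h4).resolve_left h2
  -- (2) `ε σ = 1 ⟹ χ σ = 1`
  have h2' : ∀ σ, ε σ = 1 → χ σ = 1 := by
    intro σ hσ
    by_contra hχσ
    have hχ' : ((χ σ : ℤˣ) : ℤ) = -1 := by rw [(Int.units_eq_one_or (χ σ)).resolve_left hχσ]; rfl
    -- `B = 0`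
    obtain ⟨v, hv⟩ := exists_ne (0 : V)
    have hφv : σ • φ v ≠ 0 := fun h ↦ hv (hφinj v (by
      have := congrArg (fun w ↦ σ⁻¹ • w) h
      simpa only [inv_smul_smul, smul_zero] using this))
    have hB0 : B = 0 := by
      have h3 := hψ σ v
      rw [hσ, Units.val_one, one_zsmul, hψv, hψv, hsemi, hχ', neg_one_zsmul, smul_add, hσq, hσq,
        smul_neg, add_right_inj, neg_eq_iff_add_eq_zero, ← two_smul (ZMod ℓ), smul_smul] at h3
      rcases smul_eq_zero.1 h3 with h | h
      · exact (mul_eq_zero.1 h).resolve_left h2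
      · exact absurd h hφv
    apply hscalar ψ A hψns
    rw [show ((ψ : V →+ V).toZModLinearMap ℓ) = ψL from rfl, hψAB, hB0, zero_smul, add_zero]
  intro σ
  rcases Int.units_eq_one_or (χ σ) with h | h <;> rcases Int.units_eq_one_or (ε σ) with h' | h'
  · rw [h, h']
  · exact absurd (h1 σ h) (by rw [h']; decide)
  · exact absurd (h2' σ h') (by rw [h]; decide)
  · rw [h, h']

/-! ## The module in matrices -/


namespace CMTorsion

section Plane

variable {Γ V : Type} [Group Γ] [AddCommGroup V] [DistribMulAction Γ V] {ℓ : ℕ} [Fact ℓ.Prime]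
  [Module (ZMod ℓ) V]

/-- **The FACT-2 plane and the equivariant `j : V → V^r` in `2 × 2` matrices over `𝔽_ℓ`** (in a
basis of `V`): `Φ² = D`, `Φ` non-scalar, the matrices `S_σ` of `ker χ` commute with `Φ` and are
multiplicative in `σ`, the components `J_k` of `j` satisfy `J_k S_σ = ∑ᵢ c̄(σ)_{ki} S_σ J_i`, a left
inverse of the injective `j` gives `∑ L_k J_k = 1`, and the Cartan clause reads
`S_σ = (a + b Φ)^{12}`. [folklore] -/
theorem matrices_of_module (hcard : Nat.card V = ℓ ^ 2)
    (φ : AddMonoid.End V) (D : ℤ) (χ : Γ →* ℤˣ)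
    (hφφ : ∀ v, φ (φ v) = D • v) (hns : ∀ c : ℤ, ∃ v, φ v ≠ c • v)
    (hsemi : ∀ (σ : Γ) (v : V), φ (σ • v) = ((χ σ : ℤˣ) : ℤ) • σ • φ v)
    (hbig : ∀ a b : ℤ, ¬ (ℓ : ℤ) ∣ a ^ 2 - D * b ^ 2 → ∃ σ : Γ, χ σ = 1 ∧ ∀ v : V,
      σ • v = (((a : AddMonoid.End V) + (b : AddMonoid.End V) * φ) ^ 12) v)
    {r : ℕ} (c : Γ → Matrix (Fin r) (Fin r) ℤ)
    (j : V →+ (Fin r → V)) (hj : Function.Injective j)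
    (hjσ : ∀ σ : Γ, χ σ = 1 → ∀ v : V, j (σ • v) = fun k ↦ ∑ i, c σ k i • σ • j v i) :
    ∃ (Φ : Matrix (Fin 2) (Fin 2) (ZMod ℓ)) (Sm : Γ → Matrix (Fin 2) (Fin 2) (ZMod ℓ))
      (JM LM : Fin r → Matrix (Fin 2) (Fin 2) (ZMod ℓ)),
      Φ * Φ = ((D : ℤ) : ZMod ℓ) • (1 : Matrix (Fin 2) (Fin 2) (ZMod ℓ)) ∧
      (¬ ∃ e : ZMod ℓ, Φ = e • (1 : Matrix (Fin 2) (Fin 2) (ZMod ℓ))) ∧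
      (∀ σ, χ σ = 1 → Sm σ * Φ = Φ * Sm σ) ∧
      (∀ σ τ, Sm (σ * τ) = Sm σ * Sm τ) ∧ Sm 1 = 1 ∧
      (∀ σ, χ σ = 1 → ∀ k, JM k * Sm σ = ∑ i, ((c σ k i : ℤ) : ZMod ℓ) • (Sm σ * JM i)) ∧
      ∑ k, LM k * JM k = 1 ∧
      (∀ a b : ℤ, ¬ (ℓ : ℤ) ∣ a ^ 2 - D * b ^ 2 → ∃ σ : Γ, χ σ = 1 ∧
        Sm σ = (((a : ℤ) : ZMod ℓ) • (1 : Matrix (Fin 2) (Fin 2) (ZMod ℓ)) +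
          ((b : ℤ) : ZMod ℓ) • Φ) ^ 12) := by
  classical
  have hprime : ℓ.Prime := Fact.out
  haveI : Finite V := Nat.finite_of_card_ne_zero (by rw [hcard]; exact pow_ne_zero _ hprime.ne_zero)
  haveI : Nontrivial V := by
    rw [← Finite.one_lt_card_iff_nontrivial, hcard]
    exact Nat.one_lt_pow two_ne_zero hprime.one_lt
  haveI : Module.Finite (ZMod ℓ) V := Module.Finite.of_finite
  have hrank : Module.finrank (ZMod ℓ) V = 2 := by
    have h := Module.natCard_eq_pow_finrank (K := ZMod ℓ) (V := V)
    rw [hcard, Nat.card_zmod] at h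
    exact (Nat.pow_right_injective hprime.two_le h).symm
  let bV := Module.finBasisOfFinrankEq (ZMod ℓ) V hrank
  let toA := LinearMap.toMatrixAlgEquiv bV
  have hmul : ∀ (f g : AddMonoid.End V) (v : V), (f * g) v = f (g v) := fun _ _ _ ↦ rfl
  have hadd : ∀ (f g : AddMonoid.End V) (v : V), (f + g) v = f v + g v := fun _ _ _ ↦ rfl
  -- linear versions
  let φL : Module.End (ZMod ℓ) V := (φ : V →+ V).toZModLinearMap ℓ
  let σL : Γ → Module.End (ZMod ℓ) V := fun σ ↦ (DistribSMul.toAddMonoidHom V σ).toZModLinearMap ℓ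
  let Jk : Fin r → Module.End (ZMod ℓ) V := fun k ↦
    ((Pi.evalAddMonoidHom (fun _ ↦ V) k).comp (j : V →+ (Fin r → V))).toZModLinearMap ℓ
  let jL : V →ₗ[ZMod ℓ] (Fin r → V) := (j : V →+ (Fin r → V)).toZModLinearMap ℓ
  have hφL : ∀ v, φL v = φ v := fun _ ↦ rfl
  have hσL : ∀ σ v, σL σ v = σ • v := fun _ _ ↦ rfl
  have hJk : ∀ k v, Jk k v = j v k := fun _ _ ↦ rfl
  have hjL : ∀ v, jL v = j v := fun _ ↦ rfl
  -- a left inverse of `j`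
  obtain ⟨g, hg⟩ := LinearMap.exists_leftInverse_of_injective jL (LinearMap.ker_eq_bot.2 hj)
  let Lk : Fin r → Module.End (ZMod ℓ) V := fun k ↦ g.comp (LinearMap.single (ZMod ℓ) (fun _ ↦ V) k)
  refine ⟨toA φL, fun σ ↦ toA (σL σ), fun k ↦ toA (Jk k), fun k ↦ toA (Lk k), ?_, ?_, ?_, ?_, ?_,
      ?_, ?_, ?_⟩
  · -- `Φ² = D`
    rw [← map_mul, ← map_one toA, ← map_smul]
    refine congrArg toA (LinearMap.ext fun v ↦ ?_)
    rw [Module.End.mul_apply, hφL, hφL, hφφ, LinearMap.smul_apply, Module.End.one_apply,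
      Int.cast_smul_eq_zsmul]
  · -- `Φ` is not a scalar
    rintro ⟨e, he⟩
    rw [← map_one toA, ← map_smul] at he
    have he' : φL = e • 1 := toA.injective he
    obtain ⟨v, hv⟩ := hns (e.val : ℤ)
    apply hv
    rw [← hφL, he', LinearMap.smul_apply, Module.End.one_apply]
    conv_rhs => rw [natCast_zsmul, ← Nat.cast_smul_eq_nsmul (ZMod ℓ), ZMod.natCast_zmod_val]
  · -- `Γ_K` commutes with `φ`
    intro σ hσ
    rw [← map_mul, ← map_mul]
    refine congrArg toA (LinearMap.ext fun v ↦ ?_)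
    rw [Module.End.mul_apply, Module.End.mul_apply, hσL, hφL, hφL, hσL, hsemi, hσ, Units.val_one,
      one_zsmul]
  · -- multiplicativity of the action
    intro σ τ
    rw [← map_mul]
    refine congrArg toA (LinearMap.ext fun v ↦ ?_)
    rw [Module.End.mul_apply, hσL, hσL, hσL, mul_smul]
  · rw [← map_one toA]
    refine congrArg toA (LinearMap.ext fun v ↦ ?_)
    rw [hσL, one_smul, Module.End.one_apply]
  · -- the equivariance of `j`
    intro σ hσ k
    rw [← map_mul]
    simp_rw [← map_mul, ← map_smul toA, ← map_sum]
    refine congrArg toA (LinearMap.ext fun v ↦ ?_)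
    rw [Module.End.mul_apply, hJk, hσL, hjσ σ hσ v, LinearMap.sum_apply]
    refine Finset.sum_congr rfl fun i _ ↦ ?_
    rw [LinearMap.smul_apply, Module.End.mul_apply, hσL, hJk, Int.cast_smul_eq_zsmul]
  · -- `∑ L_k J_k = 1`
    simp_rw [← map_mul]
    rw [← map_sum, ← map_one toA]
    refine congrArg toA (LinearMap.ext fun v ↦ ?_)
    rw [LinearMap.sum_apply, Module.End.one_apply]
    have h1 : ∀ k, (Lk k * Jk k) v = g (Pi.single k (j v k)) := fun k ↦ rfl
    simp_rw [h1]
    rw [← map_sum]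
    have h2 : (∑ x, Pi.single x (j v x)) = j v := by
      ext i
      simp
    rw [h2]
    exact LinearMap.congr_fun hg v
  · -- the Cartan clause
    intro a b hab
    obtain ⟨σ, hσ1, hσ⟩ := hbig a b hab
    refine ⟨σ, hσ1, ?_⟩
    rw [← map_one toA, ← map_smul, ← map_smul, ← map_add, ← map_pow]
    refine congrArg toA ?_
    have hpow : ∀ (n : ℕ) (v : V), (((a : AddMonoid.End V) + (b : AddMonoid.End V) * φ) ^ n) v =
        ((((a : ℤ) : ZMod ℓ) • (1 : Module.End (ZMod ℓ) V) + ((b : ℤ) : ZMod ℓ) • φL) ^ n) v := by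
      intro n
      induction n with
      | zero => intro v; rw [pow_zero, pow_zero, AddMonoid.End.one_apply, Module.End.one_apply]
      | succ n ih =>
        intro v
        rw [pow_succ, pow_succ, hmul, Module.End.mul_apply, ← ih]
        congr 1
        rw [hadd, hmul, AddMonoid.End.intCast_apply, AddMonoid.End.intCast_apply,
            LinearMap.add_apply,
          LinearMap.smul_apply, LinearMap.smul_apply, Module.End.one_apply, hφL,
              Int.cast_smul_eq_zsmul,
          Int.cast_smul_eq_zsmul]
    refine LinearMap.ext fun v ↦ ?_
    rw [hσL, hσ, hpow]

end Plane

end CMTorsion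

end Summit.ABC.ABC.Theorems.IsotypicMinkowski

end
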